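import Literature.AnabelianGeometry.EtaleTheta.ThetaQuotientsOfCurve
import Literature.AnabelianGeometry.AbsoluteAnabelian.LocalReciprocityCofinal
import Literature.IUT.HodgeTheaters.ProfiniteCompletionRestrictOpen
import HarnessLib

/-!
# [EtTh] §1 p. 12: the PROFINITE theta quotient `Π_X ↠ Π_X/[Δ_X,[Δ_X,Δ_X]]⁻` of ANY tempered curve record, and
# `(Π^tp_X)^Θ → ((Π^tp_X)^Θ)^∧` IS a profinite completion (construction over the L3 interface `TemperedCurve p`)

S. Mochizuki, *The Étale Theta Function …* [EtTh], Publ. RIMS **45** (2009), §1, PDF p. 12 (PRIMS p. 238): "Write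
`Π_X = (Π^tp_X)^∧`; `Δ_X = (Δ^tp_X)^∧` [where the `∧` denotes the profinite completion]"; "we write
`Δ^Θ_X = Δ_X/[Δ_X,[Δ_X,Δ_X]]`"; "we shall write `Π^tp_X ↠ (Π^tp_X)^Θ ↠ (Π^tp_X)^ell` for the quotients whose
kernels are the kernels of the quotients `Δ^tp_X ↠ (Δ^tp_X)^Θ ↠ (Δ^tp_X)^ell`", themselves "induced by the
quotients `Δ_X ↠ Δ^Θ_X ↠ Δ^ell_X`" [cite: MochizukiEtTh2009, §1 p.12]; Remark 1.6.4, PDF p. 26 (PRIMS p. 252):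
"[easier] profinite versions of the constructions given in the present §1" [cite: MochizukiEtTh2009, Rmk 1.6.4 p.26].

Layer L2 of the abc-iut cell, seat abc-iut-f-142 gen 8, row «HATTHETA-OF-CURVE» (self-named on abc-iut-L2-lead
gen 8's R1227 path "EtTh:Rmk1.6.4 … class unchanged until D1 v2 + hatClass land"): the CARRIER-INDEPENDENT
CONSTRUCTION (class (b): new definitions over abc-iut-L3's frozen `SemiGraphs.TemperedCurve` and abc-iut-L2-d1's
`CurveTheta` block of `ThetaQuotientsOfCurve.lean`; no interface clause touched) of the PROFINITE side of print's
p. 12 theta quotient for an ARBITRARY `X : TemperedCurve p`: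

* `thetaKerHat X := [[Δ_X,Δ_X],Δ_X]⁻ ≤ Π_X` (closed normal; its pull-back along `toHat` is L2-d1's `thetaKer X` by
  definition), `GThetaHat X := Π_X ⧸ thetaKerHat X` as a Mathlib `ProfiniteGrp` (compact — `Π_X` is the profinite
  completion of `Π^tp_X`; Hausdorff and totally disconnected by abc-iut-L4's
  `QuotientGroup.totallyDisconnectedSpace_of_isClosed`), `toThetaHat X : Π_X ↠ GThetaHat X`,
  `ιTheta X : (Π^tp_X)^Θ = GTheta X → GThetaHat X` induced by `toHat` (continuous for the quotient topology);
* the printed compatibilities as THEOREMS: `ιTheta_toTheta` (the square), `ker_toThetaHat`, `ιTheta_injective`,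
  `toThetaHat_surjective`, and the DENSITY LEMMA `thetaKerHat_le_closure_map_thetaKer`
  («`[[Δ_X,Δ_X],Δ_X]⁻ ⊆` closure of `toHat(toHat⁻¹[[Δ_X,Δ_X],Δ_X]⁻)`», from `⁅cl A, cl B⁆ ≤ cl ⁅A, B⁆` — twice — and
  `Δ_X := cl toHat(Δ^tp_X)`, abc-iut-L3's definition);
* **`isProfiniteCompletion_ιTheta`**: `(Π^tp_X)^Θ → ((Π^tp_X)^Θ)^∧` IS a profinite completion in abc-iut-L3's sense
  `IsProfiniteCompletion` — for EVERY tempered curve record, NO hypothesis (dense range from `toHat`; an open normal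
  finite-index `U ⊴ (Π^tp_X)^Θ` is cut out by the image of the closure of `toHat` of its preimage, which contains
  `thetaKerHat` by the density lemma; abc-iut-w5-d139's `isOpen_topologicalClosure_map` /
  `comap_topologicalClosure_map`, abc-iut-L5-t11's `normal_of_dense_conj` BY NAME).

This is the generic half of the inhabitant of abc-iut-f-142's record `ThetaSetting.HatTheta` (`ThetaSettingHatTheta.lean`,
p504464) at curve-based theta settings (`ThetaSettingHatThetaOfCurve.lean`).  HONEST FRAMING: plain topological group
theory over OUR interfaces; nothing of [EtTh] is asserted; no side is taken on [IUTchIII] Cor. 3.12; nothing here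
asserts that abc is proved or refuted; typed ≠ proved.
-/

noncomputable section

namespace Literature.AnabelianGeometry.EtaleTheta.CurveTheta

open Topology
open Literature.AnabelianGeometry.SemiGraphs
open scoped commutatorElement

variable {p : ℕ} [Fact p.Prime] (X : TemperedCurve p)

/-! ### §1. The closed normal subgroup `[[Δ_X,Δ_X],Δ_X]⁻ ≤ Π_X` -/

/-- `[[Δ_X,Δ_X],Δ_X]⁻ ≤ Π_X`, the kernel of "`Δ_X ↠ Δ^Θ_X = Δ_X/[Δ_X,[Δ_X,Δ_X]]`" read in `Π_X` (p. 12; the closure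
makes the quotient Hausdorff, as for the tree's `thetaKer`). [cite: MochizukiEtTh2009, §1 p.12] -/
def thetaKerHat : Subgroup X.PiHat := (⁅⁅X.DeltaHat, X.DeltaHat⁆, X.DeltaHat⁆).topologicalClosure

/-- `[[Δ_X,Δ_X],Δ_X]⁻` is normal in `Π_X` (`Δ_X ⊴ Π_X`, abc-iut-L2-t7's `deltaHat_normal`). [cite: MochizukiEtTh2009, §1 p.12] -/
instance thetaKerHat_normal : (thetaKerHat X).Normal := by
  haveI := SettingCompletion.deltaHat_normal X
  unfold thetaKerHat
  exact Subgroup.is_normal_topologicalClosure _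

/-- `[[Δ_X,Δ_X],Δ_X]⁻` is closed. [cite: MochizukiEtTh2009, §1 p.12] -/
theorem isClosed_thetaKerHat : IsClosed ((thetaKerHat X : Subgroup X.PiHat) : Set X.PiHat) :=
  Subgroup.isClosed_topologicalClosure _

/-- `toHat⁻¹([[Δ_X,Δ_X],Δ_X]⁻) = Ker(Π^tp_X ↠ (Π^tp_X)^Θ)` (L2-d1's `thetaKer`, by definition).
[cite: MochizukiEtTh2009, §1 p.12] -/
theorem comap_toHat_thetaKerHat : (thetaKerHat X).comap X.toHat.toMonoidHom = thetaKer X := rfl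

/-- `[[Δ_X,Δ_X],Δ_X]⁻ ≤ Δ_X`. [cite: MochizukiEtTh2009, §1 p.12] -/
theorem thetaKerHat_le_deltaHat : thetaKerHat X ≤ X.DeltaHat := by
  haveI := SettingCompletion.deltaHat_normal X
  refine Subgroup.topologicalClosure_minimal _ (Subgroup.commutator_le_right _ _) ?_
  rw [TemperedCurve.DeltaHat]; exact Subgroup.isClosed_topologicalClosure _

/-! ### §2. The density lemma: `[[Δ_X,Δ_X],Δ_X]⁻ ⊆ cl toHat(thetaKer)` -/

/-- In a topological group, `⁅cl A, cl B⁆ ≤ cl ⁅A, B⁆` (the commutator map is continuous). [folklore] -/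
private theorem commutator_topologicalClosure_le {G : Type*} [Group G] [TopologicalSpace G] [IsTopologicalGroup G]
    (A B : Subgroup G) :
    ⁅A.topologicalClosure, B.topologicalClosure⁆ ≤ (⁅A, B⁆).topologicalClosure := by
  rw [Subgroup.commutator_le]
  intro a ha b hb
  -- `(a, b) ↦ [a, b]` maps `cl A × cl B = cl (A × B)` into `cl ⁅A, B⁆`
  have hcont : Continuous fun q : G × G => ⁅q.1, q.2⁆ := by
    simp only [commutatorElement_def]; fun_prop
  have hsub : (A : Set G) ×ˢ (B : Set G) ⊆
      (fun q : G × G => ⁅q.1, q.2⁆) ⁻¹' (((⁅A, B⁆).topologicalClosure : Subgroup G) : Set G) := by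
    rintro ⟨x, y⟩ ⟨hx, hy⟩
    exact Subgroup.le_topologicalClosure _ (Subgroup.commutator_mem_commutator hx hy)
  have hcl := closure_minimal hsub ((Subgroup.isClosed_topologicalClosure _).preimage hcont)
  have hab : (a, b) ∈ closure ((A : Set G) ×ˢ (B : Set G)) := by
    rw [closure_prod_eq]
    exact ⟨by rw [← Subgroup.topologicalClosure_coe]; exact ha, by rw [← Subgroup.topologicalClosure_coe]; exact hb⟩
  exact hcl hab

/-- `[[Δ^tp_X,Δ^tp_X],Δ^tp_X] ≤ thetaKer X = toHat⁻¹([[Δ_X,Δ_X],Δ_X]⁻)` (its `toHat`-image lies in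
`[[Δ_X,Δ_X],Δ_X]`). [cite: MochizukiEtTh2009, §1 p.12] -/
theorem tripleCommutator_deltaTemp_le_thetaKer :
    ⁅⁅X.DeltaTemp, X.DeltaTemp⁆, X.DeltaTemp⁆ ≤ thetaKer X := by
  rw [← comap_toHat_thetaKerHat, ← Subgroup.map_le_iff_le_comap, Subgroup.map_commutator,
    Subgroup.map_commutator, thetaKerHat]
  refine le_trans ?_ (Subgroup.le_topologicalClosure _)
  have hle : X.DeltaTemp.map X.toHat.toMonoidHom ≤ X.DeltaHat := by
    rw [TemperedCurve.DeltaHat]; exact Subgroup.le_topologicalClosure _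
  exact Subgroup.commutator_mono (Subgroup.commutator_mono hle hle) hle

/-- **Density lemma.** `[[Δ_X,Δ_X],Δ_X]⁻ ⊆` the closure of `toHat(thetaKer X)` in `Π_X`: with
`Δ_X = cl toHat(Δ^tp_X)` (abc-iut-L3's definition) and `T := toHat(Δ^tp_X)`,
`[[Δ_X,Δ_X],Δ_X] = [[cl T, cl T], cl T] ⊆ [cl [T,T], cl T] ⊆ cl [[T,T],T] = cl toHat([[Δ^tp,Δ^tp],Δ^tp]) ⊆ cl toHat(thetaKer)`.
[cite: MochizukiEtTh2009, §1 p.12] -/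
theorem thetaKerHat_le_closure_map_thetaKer :
    thetaKerHat X ≤ ((thetaKer X).map X.toHat.toMonoidHom).topologicalClosure := by
  set T : Subgroup X.PiHat := X.DeltaTemp.map X.toHat.toMonoidHom with hT
  have hΔ : X.DeltaHat = T.topologicalClosure := by rw [TemperedCurve.DeltaHat]
  -- `[[cl T, cl T], cl T] ≤ cl [[T,T],T]`
  have h1 : ⁅⁅X.DeltaHat, X.DeltaHat⁆, X.DeltaHat⁆ ≤ (⁅⁅T, T⁆, T⁆).topologicalClosure := by
    rw [hΔ]
    calc ⁅⁅T.topologicalClosure, T.topologicalClosure⁆, T.topologicalClosure⁆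
        ≤ ⁅(⁅T, T⁆).topologicalClosure, T.topologicalClosure⁆ :=
          Subgroup.commutator_mono (commutator_topologicalClosure_le T T) le_rfl
      _ ≤ (⁅⁅T, T⁆, T⁆).topologicalClosure := commutator_topologicalClosure_le _ _
  -- `[[T,T],T] = toHat([[Δ^tp,Δ^tp],Δ^tp]) ≤ toHat(thetaKer)`
  have h2 : ⁅⁅T, T⁆, T⁆ ≤ (thetaKer X).map X.toHat.toMonoidHom := by
    rw [hT, ← Subgroup.map_commutator, ← Subgroup.map_commutator]
    exact Subgroup.map_mono (tripleCommutator_deltaTemp_le_thetaKer X)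
  rw [thetaKerHat]
  exact Subgroup.topologicalClosure_minimal _
    (h1.trans (Subgroup.topologicalClosure_mono h2)) (Subgroup.isClosed_topologicalClosure _)

/-! ### §3. The profinite theta quotient `Π_X ⧸ [[Δ_X,Δ_X],Δ_X]⁻` and the map from `(Π^tp_X)^Θ` -/

/-- `Π_X` is compact (it is the profinite completion of `Π^tp_X`). [cite: MochizukiSemiAnbd2006, §6 p.69] -/
theorem compactSpace_piHat : CompactSpace X.PiHat := X.isProfiniteCompletion_toHat.compactSpace

/-- `Π_X` is totally disconnected. [cite: MochizukiSemiAnbd2006, §6 p.69] -/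
theorem totallyDisconnectedSpace_piHat : TotallyDisconnectedSpace X.PiHat :=
  X.isProfiniteCompletion_toHat.totallyDisconnectedSpace

/-- `Π_X ⧸ [[Δ_X,Δ_X],Δ_X]⁻` is compact. [cite: MochizukiEtTh2009, §1 p.12] -/
theorem compactSpace_quot : CompactSpace (X.PiHat ⧸ thetaKerHat X) := by
  haveI := compactSpace_piHat X
  infer_instance

/-- `Π_X ⧸ [[Δ_X,Δ_X],Δ_X]⁻` is totally disconnected (abc-iut-L4's
`QuotientGroup.totallyDisconnectedSpace_of_isClosed`). [cite: MochizukiEtTh2009, §1 p.12] -/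
theorem totallyDisconnectedSpace_quot : TotallyDisconnectedSpace (X.PiHat ⧸ thetaKerHat X) := by
  haveI := compactSpace_piHat X
  haveI := totallyDisconnectedSpace_piHat X
  exact AbsoluteAnabelian.QuotientGroup.totallyDisconnectedSpace_of_isClosed _ (isClosed_thetaKerHat X)

/-- **`((Π^tp_X)^Θ)^∧ := Π_X ⧸ [[Δ_X,Δ_X],Δ_X]⁻`**, the PROFINITE theta quotient of p. 12 ("`Δ^Θ_X = Δ_X/[Δ_X,[Δ_X,Δ_X]]`"
read for `Π_X = (Π^tp_X)^∧`), bundled as a Mathlib `ProfiniteGrp`. [cite: MochizukiEtTh2009, §1 p.12] -/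
abbrev GThetaHat : ProfiniteGrp.{0} :=
  @ProfiniteGrp.of (X.PiHat ⧸ thetaKerHat X) _ _ _ (compactSpace_quot X) (totallyDisconnectedSpace_quot X)

/-- `Π_X ↠ ((Π^tp_X)^Θ)^∧`, the quotient map (p. 12). [cite: MochizukiEtTh2009, §1 p.12] -/
def toThetaHat : X.PiHat →ₜ* GThetaHat X where
  toMonoidHom := QuotientGroup.mk' (thetaKerHat X)
  continuous_toFun := QuotientGroup.continuous_mk

/-- `toThetaHat` is the quotient map (pointwise). [cite: MochizukiEtTh2009, §1 p.12] -/
theorem toThetaHat_apply (g : X.PiHat) : toThetaHat X g = (QuotientGroup.mk g : X.PiHat ⧸ thetaKerHat X) := rfl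

/-- `Ker(Π_X ↠ ((Π^tp_X)^Θ)^∧) = [[Δ_X,Δ_X],Δ_X]⁻`. [cite: MochizukiEtTh2009, §1 p.12] -/
theorem ker_toThetaHat : (toThetaHat X).toMonoidHom.ker = thetaKerHat X := QuotientGroup.ker_mk' _

/-- `Π_X ↠ ((Π^tp_X)^Θ)^∧` is surjective. [cite: MochizukiEtTh2009, §1 p.12] -/
theorem toThetaHat_surjective : Function.Surjective (toThetaHat X) := QuotientGroup.mk'_surjective _

/-- `Π_X ↠ ((Π^tp_X)^Θ)^∧` is an open map. [cite: MochizukiEtTh2009, §1 p.12] -/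
theorem isOpenMap_toThetaHat : IsOpenMap (toThetaHat X) := QuotientGroup.isOpenMap_coe

/-- `(Π^tp_X)^Θ → ((Π^tp_X)^Θ)^∧`, induced by `toHat : Π^tp_X → Π_X` (`toHat(thetaKer) ≤ thetaKerHat`), as a bare
homomorphism. [cite: MochizukiEtTh2009, §1 p.12] -/
def ιThetaHom : GTheta X →* GThetaHat X :=
  QuotientGroup.map (thetaKer X) (thetaKerHat X) X.toHat.toMonoidHom
    (by rw [← comap_toHat_thetaKerHat])

/-- The square `ιThetaHom ∘ toTheta = toThetaHat ∘ toHat` (p. 12: the tempered quotient is "induced by" the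
profinite one). [cite: MochizukiEtTh2009, §1 p.12] -/
theorem ιThetaHom_toTheta (g : X.PiTemp) : ιThetaHom X (toTheta X g) = toThetaHat X (X.toHat g) := rfl

/-- `(Π^tp_X)^Θ → ((Π^tp_X)^Θ)^∧` is continuous (`(Π^tp_X)^Θ` carries the quotient topology).
[cite: MochizukiEtTh2009, §1 p.12] -/
theorem continuous_ιThetaHom : Continuous (ιThetaHom X) := by
  rw [(QuotientGroup.isQuotientMap_mk (thetaKer X)).continuous_iff]
  exact (toThetaHat X).continuous.comp X.toHat.continuous

/-- **`ιTheta : (Π^tp_X)^Θ → ((Π^tp_X)^Θ)^∧`**, the map to the profinite theta quotient (p. 12), as a continuous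
homomorphism. [cite: MochizukiEtTh2009, §1 p.12] -/
def ιTheta : GTheta X →ₜ* GThetaHat X where
  toMonoidHom := ιThetaHom X
  continuous_toFun := continuous_ιThetaHom X

/-- The square `ιTheta ∘ toTheta = toThetaHat ∘ toHat` on `Π^tp_X`. [cite: MochizukiEtTh2009, §1 p.12] -/
theorem ιTheta_toTheta (g : X.PiTemp) : ιTheta X (toTheta X g) = toThetaHat X (X.toHat g) := rfl

/-- `ιTheta` is injective (`thetaKer = toHat⁻¹(thetaKerHat)`). [cite: MochizukiEtTh2009, §1 p.12] -/
theorem ιTheta_injective : Function.Injective (ιTheta X) := by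
  change Function.Injective (ιThetaHom X)
  rw [← MonoidHom.ker_eq_bot_iff, ιThetaHom, QuotientGroup.ker_map, comap_toHat_thetaKerHat]
  exact QuotientGroup.map_mk'_self _

/-- `ιTheta` has dense image (`toHat` has dense image and `toThetaHat` is a continuous surjection).
[cite: MochizukiEtTh2009, §1 p.12] -/
theorem denseRange_ιTheta : DenseRange (ιTheta X) := by
  have h : DenseRange (fun g : X.PiTemp => ιTheta X (toTheta X g)) := by
    have : (fun g : X.PiTemp => ιTheta X (toTheta X g)) = toThetaHat X ∘ X.toHat := by
      funext g; exact ιTheta_toTheta X g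
    rw [this]
    exact (toThetaHat_surjective X).denseRange.comp X.isProfiniteCompletion_toHat.denseRange
      (toThetaHat X).continuous
  exact h.mono (Set.range_comp_subset_range (toTheta X) (ιTheta X))

/-! ### §4. `(Π^tp_X)^Θ → ((Π^tp_X)^Θ)^∧` is a profinite completion -/

/-- **`ιTheta : (Π^tp_X)^Θ → ((Π^tp_X)^Θ)^∧` IS a profinite completion** in the sense of [SemiAnbd] §6 (abc-iut-L3's
`IsProfiniteCompletion`), for EVERY tempered curve record and with NO hypothesis: the open normal finite-index
`U ⊴ (Π^tp_X)^Θ` is cut out by the image in `Π_X ⧸ thetaKerHat` of the closure of `toHat(U′)`, `U′` the preimage of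
`U` in `Π^tp_X` — that closure contains `thetaKerHat` by the density lemma — and "the `∧` denotes the profinite
completion" (p. 12) becomes a theorem at the Θ-level. [cite: MochizukiEtTh2009, §1 p.12] -/
theorem isProfiniteCompletion_ιTheta : IsProfiniteCompletion (ιTheta X) := by
  classical
  haveI := compactSpace_piHat X
  haveI := totallyDisconnectedSpace_piHat X
  haveI : T2Space X.PiHat := X.isProfiniteCompletion_toHat.t2Space
  haveI := compactSpace_quot X
  haveI := totallyDisconnectedSpace_quot X
  refine
    { compactSpace := inferInstanceAs (CompactSpace (X.PiHat ⧸ thetaKerHat X))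
      t2Space := inferInstanceAs (T2Space (X.PiHat ⧸ thetaKerHat X))
      totallyDisconnectedSpace := inferInstanceAs (TotallyDisconnectedSpace (X.PiHat ⧸ thetaKerHat X))
      denseRange := denseRange_ιTheta X
      comap_surjective := ?_
      isOpen_comap := fun V => V.toOpenSubgroup.isOpen.preimage (ιTheta X).continuous }
  intro U hU
  haveI := hU
  -- the preimage `U'` of `U` in `Π^tp_X`: open, normal, of finite index, containing `thetaKer`
  set U' : Subgroup X.PiTemp := U.toSubgroup.comap (toTheta X) with hU'def
  have hU'o : IsOpen (U' : Set X.PiTemp) := U.toOpenSubgroup.isOpen.preimage (continuous_toTheta X)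
  haveI hU'n : U'.Normal := Subgroup.Normal.comap inferInstance _
  haveI hU'fi : U'.FiniteIndex := by
    rw [hU'def, Subgroup.finiteIndex_iff, Subgroup.index_comap_of_surjective _ (toTheta_surjective X)]
    exact hU.index_ne_zero
  have hker : thetaKer X ≤ U' := by
    intro x hx
    rw [hU'def, Subgroup.mem_comap]
    have : toTheta X x = 1 := by rwa [← MonoidHom.mem_ker, ker_toTheta]
    rw [this]; exact U.toSubgroup.one_mem
  -- the closure `W` of `toHat(U')` in `Π_X`: open, normal, pulls back to `U'`, contains `thetaKerHat`
  set W : Subgroup X.PiHat := (U'.map X.toHat.toMonoidHom).topologicalClosure with hWdef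
  have hWo : IsOpen (W : Set X.PiHat) := X.isProfiniteCompletion_toHat.isOpen_topologicalClosure_map U' hU'o
  have hWcomap : W.comap X.toHat.toMonoidHom = U' := X.isProfiniteCompletion_toHat.comap_topologicalClosure_map U' hU'o
  have hWn : W.Normal := by
    refine Literature.IUT.HodgeTheaters.ProfiniteCompletionRestrict.normal_of_dense_conj W
      (Subgroup.isClosed_topologicalClosure _) X.isProfiniteCompletion_toHat.denseRange ?_
    rintro _ ⟨x, rfl⟩ h hh
    refine Literature.IUT.HodgeTheaters.ProfiniteCompletionRestrict.conj_mem_topologicalClosure_of_forall _ _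
      (fun k hk => ?_) h hh
    obtain ⟨y, hy, rfl⟩ := hk
    exact ⟨x * y * x⁻¹, hU'n.conj_mem y hy x, by simp only [map_mul, map_inv]; rfl⟩
  have hWker : thetaKerHat X ≤ W :=
    (thetaKerHat_le_closure_map_thetaKer X).trans (Subgroup.topologicalClosure_mono (Subgroup.map_mono hker))
  -- its image `V` in the profinite theta quotient: open, normal
  let V : Subgroup (GThetaHat X) := W.map (toThetaHat X).toMonoidHom
  have hVo : IsOpen (V : Set (GThetaHat X)) := by
    change IsOpen ((toThetaHat X).toMonoidHom '' (W : Set X.PiHat))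
    exact isOpenMap_toThetaHat X _ hWo
  haveI hVn : V.Normal := Subgroup.Normal.map hWn _ (toThetaHat_surjective X)
  refine ⟨⟨⟨V, hVo⟩, hVn⟩, ?_⟩
  -- `ιTheta⁻¹(V) = U`
  ext u
  obtain ⟨g, rfl⟩ := QuotientGroup.mk_surjective u
  change (toTheta X g ∈ U.toSubgroup) ↔ ιTheta X (toTheta X g) ∈ V
  rw [ιTheta_toTheta]
  constructor
  · intro hg
    exact ⟨X.toHat g, Subgroup.le_topologicalClosure _ ⟨g, hg, rfl⟩, rfl⟩
  · rintro ⟨w, hw, hwg⟩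
    -- `toHat g ∈ w · thetaKerHat ⊆ W`
    have hmem : X.toHat g ∈ W := by
      have h1 : (toThetaHat X).toMonoidHom w = (toThetaHat X).toMonoidHom (X.toHat g) := hwg
      rw [← inv_mul_eq_one, ← map_inv, ← map_mul, ← MonoidHom.mem_ker, ker_toThetaHat] at h1
      have h2 : w⁻¹ * X.toHat g ∈ W := hWker h1
      simpa using W.mul_mem hw h2
    have : g ∈ W.comap X.toHat.toMonoidHom := hmem
    rw [hWcomap] at this
    exact this

end Literature.AnabelianGeometry.EtaleTheta.CurveTheta

end
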